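import Summits.RiemannHypothesis.RiemannHypothesis.Theses.NbSectionZeroLaw
import Summits.RiemannHypothesis.RiemannHypothesis.Theorems.Splittings.NbTruncationD
import HarnessLib

/-!
# Route NbSectionZeroLaw — `ZeroBasedClosure` for the small sections `M = 1, 2` (support for item
# stmt-RiemannHypothesis-23095, the planner's registered stub `stub_le_two`)

`ZeroBasedClosure` («zero-based closure», the XL conjecture of route `NbSectionZeroLaw`) asks, for
every section `ζ_M` (`M ≥ 1`) and every `ε > 0`, for a finite zero certificate `(ρ, x)` and a
Dirichlet polynomial `A_a` with
`∫⁻ ‖1 − ζ_M A_a‖² dt/(1/4+t²) ≤ ofReal(2π ‖Σ conj(x_i)/ρ_i‖²/Re Q(x,ρ) + ε)`.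
For `M = 1, 2` the sections have NO zeros right of `Re s = 1/2` (`ζ_1 = 1`; the zeros of
`ζ_2 = 1 + 2^{-s}` lie on `Re s = 0`), so the only admissible certificate is the EMPTY one, whose
value is `0`, and the statement reduces to `FIN_1`, `FIN_2` — the truncated distances tend to `0` —
which the tree holds (`Splittings.NbTruncation.truncFin_one`, `truncFin_two`, lane (xv-V)).  This
file discharges exactly that case (`zeroBasedClosure_of_le_two`), i.e. the planner's stub
`stub_le_two`; the case `M ≥ 3` (a NONEMPTY certificate exhausting the distance) is the conjecture
proper and is not touched.

RH-free; no definitions; standard axioms.  References: L. Báez-Duarte, Rend. Lincei 14 (2003);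
N. Nikolski, Ann. Inst. Fourier 45 (1995).  No summit is proved by this file; nothing here bears on
the truth of RH.
-/

noncomputable section

-- D-0017: `Summit.<S>.<S>.…` is the designed namespace of a single-problem summit.
set_option linter.dupNamespace false

open scoped Real ComplexConjugate
open MeasureTheory Complex Finset

namespace Summit.RiemannHypothesis.RiemannHypothesis.Theorems.NbSectionZeroLaw

open Literature.Barriers.RiemannHypothesis
open Summit.RiemannHypothesis.RiemannHypothesis.Theorems.Splittings

/-- **`ZeroBasedClosure` for `M ∈ {1, 2}` (empty certificate).** For `M = 1, 2` and every `ε > 0`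
there are a (here: the empty) zero certificate and `N, a` with
`∫⁻ ‖1 − ζ_M A_a‖² dt/(1/4+t²) ≤ ofReal(2π‖Σ conj(x_i)/ρ_i‖²/Re Q + ε) = ofReal ε` — from `FIN_1`,
`FIN_2` of the tree (`NbTruncation.truncFin_one/_two`).  The planner's stub `stub_le_two` of item
stmt-RiemannHypothesis-23095. [cite: BaezDuarte2003, Theorem 1.1 (the distance in Dirichlet form)] -/
theorem zeroBasedClosure_of_le_two (M : ℕ) (hM : 1 ≤ M) (hM2 : M ≤ 2) (ε : ℝ) (hε : 0 < ε) :
    ∃ (k : ℕ) (ρ x : Fin k → ℂ), (∀ i, zetaPartialSum M (ρ i) = 0 ∧ 1 / 2 < (ρ i).re) ∧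
      ∃ (N : ℕ) (a : Fin N → ℂ), ∫⁻ t : ℝ, ENNReal.ofReal (‖1 - zetaPartialSum M
        (1 / 2 + t * Complex.I) * ∑ n : Fin N, a n * ((n : ℂ) + 1) ^ (-(1 / 2 + t * Complex.I))‖ ^ 2 /
          (1 / 4 + t ^ 2)) ≤
        ENNReal.ofReal (2 * Real.pi * ‖∑ i, (starRingEnd ℂ) (x i) / ρ i‖ ^ 2 /
          (∑ i, ∑ j, x i * (starRingEnd ℂ) (x j) * ∑' m : ℕ, ((m : ℂ) + 1) * ((m : ℂ) + 2) *
            (starRingEnd ℂ) (((m : ℂ) + 1) ^ (-ρ i) - ((m : ℂ) + 2) ^ (-ρ i)) *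
              (((m : ℂ) + 1) ^ (-ρ j) - ((m : ℂ) + 2) ^ (-ρ j)) /
                ((starRingEnd ℂ) (ρ i) * ρ j)).re + ε) := by
  refine ⟨0, Fin.elim0, Fin.elim0, fun i ↦ Fin.elim0 i, ?_⟩
  simp only [Finset.univ_eq_empty, Finset.sum_empty, norm_zero, Complex.zero_re]
  rw [show (2 * Real.pi * (0 : ℝ) ^ 2 / 0 + ε) = ε by simp]
  interval_cases M
  · obtain ⟨N, a, h⟩ := NbTruncation.truncFin_one ε hε
    exact ⟨N, a, h.le⟩
  · obtain ⟨N, a, h⟩ := NbTruncation.truncFin_two ε hε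
    exact ⟨N, a, h.le⟩

/-- The same in the item's quantifier shape, restricted to `M ≤ 2`:
`∀ M, 1 ≤ M → M ≤ 2 → ∀ ε > 0, …` (the `M ≤ 2` slice of
`…Theses.NbSectionZeroLaw.ZeroBasedClosure`). [cite: BaezDuarte2003, Theorem 1.1] -/
theorem zeroBasedClosure_slice_le_two :
    ∀ M : ℕ, 1 ≤ M → M ≤ 2 → ∀ ε : ℝ, 0 < ε → ∃ (k : ℕ) (ρ x : Fin k → ℂ),
      (∀ i, zetaPartialSum M (ρ i) = 0 ∧ 1 / 2 < (ρ i).re) ∧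
      ∃ (N : ℕ) (a : Fin N → ℂ), ∫⁻ t : ℝ, ENNReal.ofReal (‖1 - zetaPartialSum M
        (1 / 2 + t * Complex.I) * ∑ n : Fin N, a n * ((n : ℂ) + 1) ^ (-(1 / 2 + t * Complex.I))‖ ^ 2 /
          (1 / 4 + t ^ 2)) ≤
        ENNReal.ofReal (2 * Real.pi * ‖∑ i, (starRingEnd ℂ) (x i) / ρ i‖ ^ 2 /
          (∑ i, ∑ j, x i * (starRingEnd ℂ) (x j) * ∑' m : ℕ, ((m : ℂ) + 1) * ((m : ℂ) + 2) *
            (starRingEnd ℂ) (((m : ℂ) + 1) ^ (-ρ i) - ((m : ℂ) + 2) ^ (-ρ i)) *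
              (((m : ℂ) + 1) ^ (-ρ j) - ((m : ℂ) + 2) ^ (-ρ j)) /
                ((starRingEnd ℂ) (ρ i) * ρ j)).re + ε) :=
  fun M hM hM2 ε hε ↦ zeroBasedClosure_of_le_two M hM hM2 ε hε

end Summit.RiemannHypothesis.RiemannHypothesis.Theorems.NbSectionZeroLaw

end
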